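import Literature.MathematicalPhysics.QuantumLattice.DWaveSourceCanonicalClassWindowCertificate
import Summits.Ventures.CertifiedManyBodySolver.Rows.SourcedTIClassNodeShapes
import HarnessLib

/-!
# PINNING-FIELD rows: the CANONICAL-CLASS node shapes of sourced certificates WITH ground-state rows on
# number-conserving words (filling rows at `n/2`, `μ = 0`): energy floors for EVERY state of the class, K-legs on its minimisers

HONEST FRAMING: soundness glue; no certificate, no number, no order parameter, no phase word. A finite-`h` response bound
is a response, never an order parameter (cell hubbard-cq wording W1).

WHAT THIS FILE IS (cell hubbard-cq, D-0082 (c) / LADDER row PC-a, seat hubbard-cq-obsth-1 «pinning-field K5 menu nodes with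
the pinning term»). The cell's CANONICAL sourced certificates (hubbard-cq-pilot-1's E-legs at density `7/8`, `μ = 0`, filling rows;
the EE leg adds «neutral degree ≤ 2 `eom` rows»; canonical K-legs add a `kkt` block) are read by
`Literature/…/DWaveSourceCanonicalClassWindowCertificate` (hubbard-cq-obsth-1 g5): a density-`n` minimiser of `e^{src}_{0,h}` is a
Bratteli–Kishimoto–Robinson ground state of `Φ − μn − hP_d` for SOME `μ`, and `eom` / `kkt` rows on NUMBER-CONSERVING words do not
see `μ`. This file spells the node slots:

* `tiClass_sourced_meanEnergy_ge_of_twistedFlip_certificate_kkt` — ENERGY FLOORS: the SAME sentence as without ground-state rows,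
  `∀ σ, σ.IsTranslationInvariant → σ.density = n → c − Σ‖aₖ‖ ≤ e^{src}_{0,h}(σ)` (`0 < n < 2`) — because the canonical infimum is
  ATTAINED (`exists_canonicalMinimiser`) at a state where the number-conserving ground-state rows are licensed, and every other
  state of the class lies above it. So an EE-leg certificate (filling rows + neutral `eom` rows [+ `#473`-type floor row]) types into
  EXACTLY the `cert_pin1_E*` node shape of `SourcedTIClassNodeShapes`.
* `canonicalClass_re_expect_localPairAt_ge_of_twistedFlip_certificate_kkt` — canonical K-leg FLOOR (pair MIN, cap row fed by a
  canonical cap «`∃ σ TI, ρ(σ) = n, e^{src}_{0,h}(σ) ≤ u`», the cell's `exists_canonicalClass_sourced_le_…` nodes; optional floor row):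
  `∀ ω TI of density n minimising e^{src}_{0,h} at density n, m ≤ Re ω(P₀^d)` (slot `2m ≤ c − Σ‖aₖ‖`);
  `canonicalClass_re_expect_localPairAt_le_…` — the MAX twin (`Re ω(P₀^d) ≤ M`, slot `−(c − Σ‖aₖ‖) ≤ 2M`).

Identity shape: CONSUMER-GRAMMAR-KKT.md §9 LHS at `μ = 0` with filling rows at `ν = n/2` + §8/§10 ground-state blocks with
`H₀ = pairSourceWindowHamiltonianTT' dWaveFormFactor Λ' t' U 0 h`, every `eom` word `B k` and `kkt` generator `Bk b` satisfying
`Commute (totalNumber : FermionOp Λ) ·` (engine: charge-0 words). Interface note: no local instance, no definition, no named fact, no `sorry`.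

References: O. Bratteli, A. Kishimoto, D. W. Robinson, CMP 64 (1978) 41, Thm. 2 [BratteliKishimotoRobinson1978]; D. Ruelle (1969) §3.4
[Ruelle1969]; J. Wang et al., PRX 14 (2024) 031006 §III [WangEtAl2024]; M. Araújo et al., arXiv:2311.18707 §3.2 Prop. 11 [AraujoEtAl2023];
T. Koma, H. Tasaki, J. Stat. Phys. 76 (1994) 745 §1 [KomaTasaki1994].
-/

noncomputable section

namespace Summit.Ventures.CertifiedManyBodySolver

open Literature.MathematicalPhysics.QuantumLattice Literature.MathematicalPhysics.QuantumLattice.ThermodynamicLimit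
open Literature.MathematicalPhysics.QuantumManyBody.StateRelaxation
open Matrix HubbardWave0 Literature.Probability.LatticeModels Finset InfVolFermionState
open scoped BigOperators ComplexOrder

/-! ## §1 Energy floors: every state of the class -/

/-- **CANONICAL ENERGY-FLOOR NODE SHAPE with ground-state rows** (EE-leg shape): a flip-twisted sourced window certificate at
`μ = 0` with objective `Γ E^{src}_{0,h}`, per-spin filling rows at `n/2`, an optional unsourced floor row `κ⁻ (Γ E^{tt'} − ℓ·1)`
(premise on the class; `κ⁻ = 0` if absent), an `eom` block on number-conserving words `B k` and a `kkt` block on number-conserving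
generators `Bk b` (`G ⪰ 0`) proves, for `0 < n < 2`,
`∀ σ, σ.IsTranslationInvariant → σ.density = n → c − Σ‖aₖ‖ ≤ e^{src}_{0,h}(σ)` — the sentence of the `cert_pin1_E*` nodes, unchanged:
the ground-state rows are used at a density-`n` MINIMISER (it exists and is a ground state for some `μ`), and every state of the class
lies above it. [cite: WangEtAl2024, §III] [cite: BratteliKishimotoRobinson1978, Thm. 2] [cite: Ruelle1969, §3.4] -/
theorem tiClass_sourced_meanEnergy_ge_of_twistedFlip_certificate_kkt (t' U h n : ℝ) (hn0 : 0 < n) (hn2 : n < 2)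
    {Λ Λ' : Finset (Site 2)} (hΛ : Λ ⊆ Λ') (h8 : thicken Λ 1 ⊆ Λ') (h0 : thicken ({0} : Finset (Site 2)) 1 ⊆ Λ')
    (hz : (0 : Site 2) ∈ Λ') (κm lo : ℝ) (μc : Fin 2 → ℝ)
    (hlo : ∀ σ : InfVolFermionState 2, σ.IsTranslationInvariant → σ.density = n →
      κm * lo ≤ κm * σ.meanEnergy (hubbardTTPrimeFermionInteraction 1 t' U) 1)
    {m : Type*} [Fintype m] [DecidableEq m] {Λm : Matrix m m ℂ} (hΛm : Λm.PosSemidef) (O : m → FermionOp Λ')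
    {κ' : Type*} (s : Finset κ') (B : κ' → FermionOp Λ) (hB : ∀ k ∈ s, Commute (totalNumber : FermionOp Λ) (B k))
    {ι : Type*} (tt : Finset ι) (γ : ι → DihedralGroup 4) (wv : ι → Site 2) (fl mt : ι → Fin 2)
    (hsh : ∀ l, d4ShiftSet (γ l) (wv l) Λ ⊆ Λ') (bb : ι → ℂ) (yw : ι → List (Orb (PolySite Λ) × Bool))
    {δ : Type*} (ah : Finset δ) (dc : δ → ℝ) (V : δ → FermionOp Λ')
    {κ'' : Type*} (w : Finset κ'') (a : κ'' → ℂ) (word : κ'' → List (Orb (PolySite Λ') × Bool))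
    {β : Type*} [Fintype β] [DecidableEq β] {G : Matrix β β ℂ} (hG : G.PosSemidef) (Bk : β → FermionOp Λ)
    (hBk : ∀ b, Commute (totalNumber : FermionOp Λ) (Bk b)) {c : ℝ}
    (hcert : fermionEmbed (PolySite.incl h0) ((hubbardTTPrimeSourcedInteraction 1 t' U 0 dWaveFormFactor h).meanEnergyObs 1) -
        (c : ℂ) • (1 : FermionOp Λ') -
        ∑ σ : Fin 2, ((μc σ : ℝ) : ℂ) • (nAt 0 hz σ - (((n / 2 : ℝ) : ℝ) : ℂ) • (1 : FermionOp Λ')) -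
        ((κm : ℝ) : ℂ) • (fermionEmbed (PolySite.incl h0) ((hubbardTTPrimeFermionInteraction 1 t' U).meanEnergyObs 1) -
          ((lo : ℝ) : ℂ) • (1 : FermionOp Λ')) =
      gramForm Λm O +
        (∑ k ∈ s, (pairSourceWindowHamiltonianTT' dWaveFormFactor Λ' t' U 0 h * fermionEmbed (PolySite.incl hΛ) (B k) -
            fermionEmbed (PolySite.incl hΛ) (B k) * pairSourceWindowHamiltonianTT' dWaveFormFactor Λ' t' U 0 h) +
          ∑ l ∈ tt, bb l • (gaugePhase (twistFlipExp (γ l) (fl l) (mt l)) (yw l) •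
              fermionEmbed (PolySite.incl (hsh l))
                (fermionEmbed (PolySite.d4Emb (γ l) (wv l) Λ) (spinSwapIter (fl l).val (ladderWord (yw l)))) -
            fermionEmbed (PolySite.incl hΛ) (ladderWord (yw l)))) +
        (∑ m' ∈ ah, ((dc m' : ℝ) : ℂ) • ((V m')ᴴ - V m') + ∑ k ∈ w, a k • ladderWord (word k)) +
        kktForm (pairSourceWindowHamiltonianTT' dWaveFormFactor Λ' t' U 0 h) G
          (fun b' => fermionEmbed (PolySite.incl hΛ) (Bk b'))) :
    ∀ σ : InfVolFermionState 2, σ.IsTranslationInvariant → σ.density = n →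
      c - ∑ k ∈ w, ‖a k‖ ≤ σ.meanEnergy (hubbardTTPrimeSourcedInteraction 1 t' U 0 dWaveFormFactor h) 1 := by
  intro σ hσ hσρ
  -- a density-`n` minimiser carries the ground-state rows
  obtain ⟨ω, hω, hωρ, hmin⟩ := InfVolFermionState.exists_canonicalMinimiser
    (hubbardTTPrimeSourcedInteraction 1 t' U 0 dWaveFormFactor h) 1 hn0 hn2
  have hcert' : fermionEmbed (PolySite.incl h0) ((hubbardTTPrimeSourcedInteraction 1 t' U 0 dWaveFormFactor h).meanEnergyObs 1) -
        (c : ℂ) • (1 : FermionOp Λ') -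
        ∑ σ : Fin 2, ((μc σ : ℝ) : ℂ) • (nAt 0 hz σ - (((n / 2 : ℝ) : ℝ) : ℂ) • (1 : FermionOp Λ')) -
        (((0 : ℝ) : ℝ) : ℂ) • ((((0 : ℝ) : ℝ) : ℂ) • (1 : FermionOp Λ') -
          fermionEmbed (PolySite.incl h0) ((hubbardTTPrimeSourcedInteraction 1 t' U 0 dWaveFormFactor h).meanEnergyObs 1)) -
        ((κm : ℝ) : ℂ) • (fermionEmbed (PolySite.incl h0) ((hubbardTTPrimeFermionInteraction 1 t' U).meanEnergyObs 1) -
          ((lo : ℝ) : ℂ) • (1 : FermionOp Λ')) =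
      gramForm Λm O +
        (∑ k ∈ s, (pairSourceWindowHamiltonianTT' dWaveFormFactor Λ' t' U 0 h * fermionEmbed (PolySite.incl hΛ) (B k) -
            fermionEmbed (PolySite.incl hΛ) (B k) * pairSourceWindowHamiltonianTT' dWaveFormFactor Λ' t' U 0 h) +
          ∑ l ∈ tt, bb l • (gaugePhase (twistFlipExp (γ l) (fl l) (mt l)) (yw l) •
              fermionEmbed (PolySite.incl (hsh l))
                (fermionEmbed (PolySite.d4Emb (γ l) (wv l) Λ) (spinSwapIter (fl l).val (ladderWord (yw l)))) -
            fermionEmbed (PolySite.incl hΛ) (ladderWord (yw l)))) +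
        (∑ m' ∈ ah, ((dc m' : ℝ) : ℂ) • ((V m')ᴴ - V m') + ∑ k ∈ w, a k • ladderWord (word k)) +
        kktForm (pairSourceWindowHamiltonianTT' dWaveFormFactor Λ' t' U 0 h) G
          (fun b' => fermionEmbed (PolySite.incl hΛ) (Bk b')) := by
    rw [Complex.ofReal_zero, zero_smul, sub_zero]; exact hcert
  have hmain := hω.le_meanEnergy_sourced_of_twistedFlip_certificate_kkt_canonical hωρ hn0 hn2 hmin hΛ h8 h0 hz 0 κm 0 lo μc
    (n / 2) (by simp) (fun σ' hσ' hρ' => hlo σ' hσ' (hρ'.trans hωρ)) hΛm O s B hB tt γ wv fl mt hsh bb yw ah dc V w a word hG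
    Bk hBk hcert'
  rw [hωρ, sub_self, mul_zero, add_zero] at hmain
  exact hmain.trans (hmin σ hσ hσρ)

/-! ## §2 Canonical K-legs: the minimisers of the class -/

/-- **CANONICAL K-LEG FLOOR NODE SHAPE** (pair MIN with number-conserving ground-state rows, filling rows at `n/2`, cap row
`κ⁺ ((u:ℚ)·1 − Γ E^{src}_{0,h})` with `κ⁺ ≥ 0` fed by a canonical cap «`∃ σ TI, ρ(σ) = n, e^{src}_{0,h}(σ) ≤ u`», optional floor row
on the class) proves, for `0 < n < 2` and a slot `2m ≤ c − Σ‖aₖ‖`: for every translation-invariant `ω` of density `n` MINIMISING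
`e^{src}_{0,h}` among such states, `m ≤ Re ω(P₀^d)` — a finite-`h` RESPONSE floor on the canonical ground states (not an order
parameter; the rows bind only on minimisers, so NO «every σ of the class» sentence follows for the pair objective).
[cite: KomaTasaki1994, §1] [cite: WangEtAl2024, §III] [cite: AraujoEtAl2023, §3.2 Prop. 11] -/
theorem canonicalClass_re_expect_localPairAt_ge_of_twistedFlip_certificate_kkt (t' U h n : ℝ) (hn0 : 0 < n) (hn2 : n < 2)
    {Λ Λ' : Finset (Site 2)} (hΛ : Λ ⊆ Λ') (h8 : thicken Λ 1 ⊆ Λ') (h0 : thicken ({0} : Finset (Site 2)) 1 ⊆ Λ')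
    (hz : (0 : Site 2) ∈ Λ') (hP : pairRegion (insert (0 : Site 2) unitSteps) 0 ⊆ Λ')
    {κp : ℝ} (hκ : 0 ≤ κp) {u : ℚ}
    (hcapW : ∃ σ : InfVolFermionState 2, σ.IsTranslationInvariant ∧ σ.density = n ∧
      σ.meanEnergy (hubbardTTPrimeSourcedInteraction 1 t' U 0 dWaveFormFactor h) 1 ≤ ((u : ℚ) : ℝ))
    (κm lo : ℝ) (μc : Fin 2 → ℝ)
    (hlo : ∀ σ : InfVolFermionState 2, σ.IsTranslationInvariant → σ.density = n →
      κm * lo ≤ κm * σ.meanEnergy (hubbardTTPrimeFermionInteraction 1 t' U) 1)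
    {m : Type*} [Fintype m] [DecidableEq m] {Λm : Matrix m m ℂ} (hΛm : Λm.PosSemidef) (O : m → FermionOp Λ')
    {κ' : Type*} (s : Finset κ') (B : κ' → FermionOp Λ) (hB : ∀ k ∈ s, Commute (totalNumber : FermionOp Λ) (B k))
    {ι : Type*} (tt : Finset ι) (γ : ι → DihedralGroup 4) (wv : ι → Site 2) (fl mt : ι → Fin 2)
    (hsh : ∀ l, d4ShiftSet (γ l) (wv l) Λ ⊆ Λ') (bb : ι → ℂ) (yw : ι → List (Orb (PolySite Λ) × Bool))
    {δ : Type*} (ah : Finset δ) (dc : δ → ℝ) (V : δ → FermionOp Λ')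
    {κ'' : Type*} (w : Finset κ'') (a : κ'' → ℂ) (word : κ'' → List (Orb (PolySite Λ') × Bool))
    {β : Type*} [Fintype β] [DecidableEq β] {G : Matrix β β ℂ} (hG : G.PosSemidef) (Bk : β → FermionOp Λ)
    (hBk : ∀ b, Commute (totalNumber : FermionOp Λ) (Bk b)) {c mfl : ℝ} (hm : 2 * mfl ≤ c - ∑ k ∈ w, ‖a k‖)
    (hcert : (fermionEmbed (PolySite.incl hP) (localPairAt (insert (0 : Site 2) unitSteps) dWaveFormFactor 0) +
          (fermionEmbed (PolySite.incl hP) (localPairAt (insert (0 : Site 2) unitSteps) dWaveFormFactor 0))ᴴ) -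
        (c : ℂ) • (1 : FermionOp Λ') -
        ∑ σ : Fin 2, ((μc σ : ℝ) : ℂ) • (nAt 0 hz σ - (((n / 2 : ℝ) : ℝ) : ℂ) • (1 : FermionOp Λ')) -
        ((κp : ℝ) : ℂ) • ((((u : ℚ) : ℝ) : ℂ) • (1 : FermionOp Λ') -
          fermionEmbed (PolySite.incl h0) ((hubbardTTPrimeSourcedInteraction 1 t' U 0 dWaveFormFactor h).meanEnergyObs 1)) -
        ((κm : ℝ) : ℂ) • (fermionEmbed (PolySite.incl h0) ((hubbardTTPrimeFermionInteraction 1 t' U).meanEnergyObs 1) -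
          ((lo : ℝ) : ℂ) • (1 : FermionOp Λ')) =
      gramForm Λm O +
        (∑ k ∈ s, (pairSourceWindowHamiltonianTT' dWaveFormFactor Λ' t' U 0 h * fermionEmbed (PolySite.incl hΛ) (B k) -
            fermionEmbed (PolySite.incl hΛ) (B k) * pairSourceWindowHamiltonianTT' dWaveFormFactor Λ' t' U 0 h) +
          ∑ l ∈ tt, bb l • (gaugePhase (twistFlipExp (γ l) (fl l) (mt l)) (yw l) •
              fermionEmbed (PolySite.incl (hsh l))
                (fermionEmbed (PolySite.d4Emb (γ l) (wv l) Λ) (spinSwapIter (fl l).val (ladderWord (yw l)))) -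
            fermionEmbed (PolySite.incl hΛ) (ladderWord (yw l)))) +
        (∑ m' ∈ ah, ((dc m' : ℝ) : ℂ) • ((V m')ᴴ - V m') + ∑ k ∈ w, a k • ladderWord (word k)) +
        kktForm (pairSourceWindowHamiltonianTT' dWaveFormFactor Λ' t' U 0 h) G
          (fun b' => fermionEmbed (PolySite.incl hΛ) (Bk b'))) :
    ∀ ω : InfVolFermionState 2, ω.IsTranslationInvariant → ω.density = n →
      (∀ σ : InfVolFermionState 2, σ.IsTranslationInvariant → σ.density = n →
        ω.meanEnergy (hubbardTTPrimeSourcedInteraction 1 t' U 0 dWaveFormFactor h) 1 ≤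
          σ.meanEnergy (hubbardTTPrimeSourcedInteraction 1 t' U 0 dWaveFormFactor h) 1) →
      mfl ≤ (ω.expect (pairRegion (insert (0 : Site 2) unitSteps) 0)
        (localPairAt (insert (0 : Site 2) unitSteps) dWaveFormFactor 0)).re := by
  intro ω hω hωρ hmin
  have hmain := hω.le_two_mul_re_expect_localPairAt_of_twistedFlip_certificate_kkt_canonical hωρ hn0 hn2 hmin hΛ h8 h0 hz hP κp
    κm ((u : ℚ) : ℝ) lo μc (n / 2) (mul_meanEnergy_sourced_le_of_canonicalCap hmin hκ hcapW)
    (fun σ' hσ' hρ' => hlo σ' hσ' (hρ'.trans hωρ)) hΛm O s B hB tt γ wv fl mt hsh bb yw ah dc V w a word hG Bk hBk hcert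
  rw [hωρ, sub_self, mul_zero, add_zero] at hmain
  linarith

/-- **CANONICAL K-LEG CEILING NODE SHAPE** (pair MAX twin; slot `−(c − Σ‖aₖ‖) ≤ 2M`): for every density-`n` minimiser `ω` of
`e^{src}_{0,h}`, `Re ω(P₀^d) ≤ M`. [cite: KomaTasaki1994, §1] [cite: WangEtAl2024, §III] -/
theorem canonicalClass_re_expect_localPairAt_le_of_twistedFlip_certificate_kkt (t' U h n : ℝ) (hn0 : 0 < n) (hn2 : n < 2)
    {Λ Λ' : Finset (Site 2)} (hΛ : Λ ⊆ Λ') (h8 : thicken Λ 1 ⊆ Λ') (h0 : thicken ({0} : Finset (Site 2)) 1 ⊆ Λ')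
    (hz : (0 : Site 2) ∈ Λ') (hP : pairRegion (insert (0 : Site 2) unitSteps) 0 ⊆ Λ')
    {κp : ℝ} (hκ : 0 ≤ κp) {u : ℚ}
    (hcapW : ∃ σ : InfVolFermionState 2, σ.IsTranslationInvariant ∧ σ.density = n ∧
      σ.meanEnergy (hubbardTTPrimeSourcedInteraction 1 t' U 0 dWaveFormFactor h) 1 ≤ ((u : ℚ) : ℝ))
    (κm lo : ℝ) (μc : Fin 2 → ℝ)
    (hlo : ∀ σ : InfVolFermionState 2, σ.IsTranslationInvariant → σ.density = n →
      κm * lo ≤ κm * σ.meanEnergy (hubbardTTPrimeFermionInteraction 1 t' U) 1)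
    {m : Type*} [Fintype m] [DecidableEq m] {Λm : Matrix m m ℂ} (hΛm : Λm.PosSemidef) (O : m → FermionOp Λ')
    {κ' : Type*} (s : Finset κ') (B : κ' → FermionOp Λ) (hB : ∀ k ∈ s, Commute (totalNumber : FermionOp Λ) (B k))
    {ι : Type*} (tt : Finset ι) (γ : ι → DihedralGroup 4) (wv : ι → Site 2) (fl mt : ι → Fin 2)
    (hsh : ∀ l, d4ShiftSet (γ l) (wv l) Λ ⊆ Λ') (bb : ι → ℂ) (yw : ι → List (Orb (PolySite Λ) × Bool))
    {δ : Type*} (ah : Finset δ) (dc : δ → ℝ) (V : δ → FermionOp Λ')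
    {κ'' : Type*} (w : Finset κ'') (a : κ'' → ℂ) (word : κ'' → List (Orb (PolySite Λ') × Bool))
    {β : Type*} [Fintype β] [DecidableEq β] {G : Matrix β β ℂ} (hG : G.PosSemidef) (Bk : β → FermionOp Λ)
    (hBk : ∀ b, Commute (totalNumber : FermionOp Λ) (Bk b)) {c M : ℝ} (hM : -(c - ∑ k ∈ w, ‖a k‖) ≤ 2 * M)
    (hcert : -(fermionEmbed (PolySite.incl hP) (localPairAt (insert (0 : Site 2) unitSteps) dWaveFormFactor 0) +
          (fermionEmbed (PolySite.incl hP) (localPairAt (insert (0 : Site 2) unitSteps) dWaveFormFactor 0))ᴴ) -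
        (c : ℂ) • (1 : FermionOp Λ') -
        ∑ σ : Fin 2, ((μc σ : ℝ) : ℂ) • (nAt 0 hz σ - (((n / 2 : ℝ) : ℝ) : ℂ) • (1 : FermionOp Λ')) -
        ((κp : ℝ) : ℂ) • ((((u : ℚ) : ℝ) : ℂ) • (1 : FermionOp Λ') -
          fermionEmbed (PolySite.incl h0) ((hubbardTTPrimeSourcedInteraction 1 t' U 0 dWaveFormFactor h).meanEnergyObs 1)) -
        ((κm : ℝ) : ℂ) • (fermionEmbed (PolySite.incl h0) ((hubbardTTPrimeFermionInteraction 1 t' U).meanEnergyObs 1) -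
          ((lo : ℝ) : ℂ) • (1 : FermionOp Λ')) =
      gramForm Λm O +
        (∑ k ∈ s, (pairSourceWindowHamiltonianTT' dWaveFormFactor Λ' t' U 0 h * fermionEmbed (PolySite.incl hΛ) (B k) -
            fermionEmbed (PolySite.incl hΛ) (B k) * pairSourceWindowHamiltonianTT' dWaveFormFactor Λ' t' U 0 h) +
          ∑ l ∈ tt, bb l • (gaugePhase (twistFlipExp (γ l) (fl l) (mt l)) (yw l) •
              fermionEmbed (PolySite.incl (hsh l))
                (fermionEmbed (PolySite.d4Emb (γ l) (wv l) Λ) (spinSwapIter (fl l).val (ladderWord (yw l)))) -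
            fermionEmbed (PolySite.incl hΛ) (ladderWord (yw l)))) +
        (∑ m' ∈ ah, ((dc m' : ℝ) : ℂ) • ((V m')ᴴ - V m') + ∑ k ∈ w, a k • ladderWord (word k)) +
        kktForm (pairSourceWindowHamiltonianTT' dWaveFormFactor Λ' t' U 0 h) G
          (fun b' => fermionEmbed (PolySite.incl hΛ) (Bk b'))) :
    ∀ ω : InfVolFermionState 2, ω.IsTranslationInvariant → ω.density = n →
      (∀ σ : InfVolFermionState 2, σ.IsTranslationInvariant → σ.density = n →
        ω.meanEnergy (hubbardTTPrimeSourcedInteraction 1 t' U 0 dWaveFormFactor h) 1 ≤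
          σ.meanEnergy (hubbardTTPrimeSourcedInteraction 1 t' U 0 dWaveFormFactor h) 1) →
      (ω.expect (pairRegion (insert (0 : Site 2) unitSteps) 0)
        (localPairAt (insert (0 : Site 2) unitSteps) dWaveFormFactor 0)).re ≤ M := by
  intro ω hω hωρ hmin
  have hmain := hω.two_mul_re_expect_localPairAt_le_of_twistedFlip_certificate_kkt_canonical hωρ hn0 hn2 hmin hΛ h8 h0 hz hP κp
    κm ((u : ℚ) : ℝ) lo μc (n / 2) (mul_meanEnergy_sourced_le_of_canonicalCap hmin hκ hcapW)
    (fun σ' hσ' hρ' => hlo σ' hσ' (hρ'.trans hωρ)) hΛm O s B hB tt γ wv fl mt hsh bb yw ah dc V w a word hG Bk hBk hcert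
  rw [hωρ, sub_self, mul_zero, add_zero] at hmain
  linarith

end Summit.Ventures.CertifiedManyBodySolver

end
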